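import Mathlib
import HarnessLib
import Summits.CriticalPhenomena.CardyFormulaZ2.Theses.CardySelfRefinement
import Literature.Probability.RandomPlanarGeometry.ChordalReversibility
import Literature.Probability.RandomPlanarGeometry.ConformalRectangle
import Literature.Probability.RandomPlanarGeometry.IsometryCovariance
import Literature.Probability.RandomPlanarGeometry.RadoContinuity

/-!
# Crux `SymmetryUpgradeR` (stmt-CriticalPhenomena-17239), line `SketchIdeatorTwo` — helper
# `exitRigidity_exitFunction` for stub `stub_exitRigidity` (FL4, "the pin")

**The exit probability of a conformal rectangle is a conformal invariant of the marked
rectangle** (first rung of the exit-function rigidity argument of idea card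
`swallowing-skeleton-rs-pin`): for a chordal family `P` that is conformally covariant
(`ChordalFamily.IsConformallyCovariant`, Werner 2007 §3.2 (1) / LSW 2004 §2), the probability

  `h_P(R) = P_{(Ω; a, c)} (the curve from a to c hits (cd) = R.arc 2 before (bc) = R.arc 1)`

is unchanged when the conformal rectangle `R = (Ω; a, b, c, d)` is replaced by its image under
any map `Φ : ℂ → ℂ` continuous on the plane, holomorphic on `Ω` and injective on `closure Ω`
(`exitRigidity_exitFunction`, image-data form of `ImageUnivalent.lean`: ANY rectangle `S` with
carrier `Φ '' Ω`, marks `Φ a`, `Φ c` and arcs `Φ '' R.arc 1`, `Φ '' R.arc 2`). Together with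
the uniformization of two conformal rectangles of equal modulus and equal boundary orientation
onto each other with vertex correspondence (Pommerenke 1992, §2.3 Ex. 2 + Thm. 2.6) this says
that `h_P` is ONE real function of the cross-ratio on each orientation class — the "exit
function" of the card. (Orientation matters: a conformal map cannot reverse the boundary
orientation, and for a chiral family the two classes may carry different functions; the stub
`stub_exitRigidity` also assumes reflection covariance `IsIsometryCovariant`, under which the
two functions agree: `exitRigidity_exitFunction_isometry`.)

The mechanism is a transport lemma on curve space (`measureReal_hitsBefore_map_eq`): if
`Ψ ∘ Φ = id` on a set `K` carrying `μ`-almost every trace, then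
`(Φ_* μ) (hitsBefore (Φ A) (Φ B)) = μ (hitsBefore A B)` for compact `A, B ⊆ K`; the left
inverse `Ψ : C(ℂ, ℂ)` of a map injective on a compact `K` comes from the continuity of the
inverse of a continuous bijection of a compact set (`continuousOn_invFunOn_of_isCompact`) and
the Tietze extension theorem (`ContinuousMap.exists_restrict_eq`, `ℂ` is a Tietze space).

## References

* W. Werner, *Lectures on two-dimensional critical percolation*, IAS/Park City (2007), §3.2.
* G. F. Lawler, O. Schramm, W. Werner, *On the scaling limit of planar self-avoiding walk*
  (2004), §2 (conformal invariance of a family of chordal laws).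
* Ch. Pommerenke, *Boundary Behaviour of Conformal Maps* (1992), Thm. 2.6, §2.3 Exercise 2.
* M. Aizenman, A. Burchard, Duke Math. J. 99 (1999), §2.1 (curve space, crossing events).
-/

noncomputable section

namespace Summit.CriticalPhenomena.CardyFormulaZ2.Theorems.SymmetryUpgradeR.SwallowingSkeleton

open MeasureTheory Filter Set
open Literature.Probability.RandomPlanarGeometry Literature.Probability.LatticeModels
  Literature.Probability.Percolation
open UpperHalfPlane (upperHalfPlaneSet)

/-! ### Transport of crossing events along maps injective on the traces -/

/-- **Push-forward of a crossing event along a map injective near the trace.** If `Φ` is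
injective on a set `K` containing `B` and the trace of the curve class `γ`, and `γ` hits `A`
before `B`, then `Φ ∘ γ` hits `Φ '' A` before `Φ '' B` (the same representative and the same
parameter witness it; injectivity on `K` prevents an early visit of `Φ '' B`). -/
theorem map_mem_hitsBefore_of_injOn {K A B : Set ℂ} {Φ : C(ℂ, ℂ)} (hΦ : InjOn Φ K) (hBK : B ⊆ K)
    {γ : CurveClass ℂ} (hγK : γ.range ⊆ K) (hγ : γ ∈ CurveClass.hitsBefore A B) :
    CurveClass.map Φ γ ∈ CurveClass.hitsBefore (Φ '' A) (Φ '' B) := by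
  obtain ⟨g, ⟨t, htA, htB⟩, rfl⟩ := hγ
  rw [CurveClass.map_mk]
  refine CurveClass.mk_mem_hitsBefore (t := t) (mem_image_of_mem Φ htA) fun s hs hmem => ?_
  rw [Curve.map_apply] at hmem
  obtain ⟨b, hb, hbs⟩ := hmem
  have hsK : g s ∈ K := hγK (by rw [CurveClass.range_mk]; exact ⟨s, rfl⟩)
  have hbg : b = g s := hΦ (hBK hb) hsK hbs
  exact htB s hs (hbg ▸ hb)

/-- **Transport of crossing probabilities along a map with a continuous left inverse on the
traces.** Let `Φ, Ψ : ℂ → ℂ` be continuous with `Ψ (Φ x) = x` on a set `K`, let `A, B ⊆ K` be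
compact, and let `μ` be a law on curve classes almost all of whose traces lie in `K`. Then
`(Φ_* μ) (hitsBefore (Φ '' A) (Φ '' B)) = μ (hitsBefore A B)` (as real numbers): modulo a
`μ`-null set the pulled-back event IS `hitsBefore A B` (`map_mem_hitsBefore_of_injOn` for `Φ`
on `K` and for `Ψ` on `Φ '' K`, and `Ψ ∘ Φ ∘ γ = γ` for traces in `K`). Crossing events of
closed sets are Borel (`CurveClass.measurableSet_hitsBefore_holds`, Aizenman–Burchard 1999
§2.1). -/
theorem measureReal_hitsBefore_map_eq {μ : Measure (CurveClass ℂ)} {K A B : Set ℂ}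
    {Φ Ψ : C(ℂ, ℂ)} (hA : IsCompact A) (hB : IsCompact B) (hAK : A ⊆ K) (hBK : B ⊆ K)
    (hΨΦ : ∀ x ∈ K, Ψ (Φ x) = x) (hμ : ∀ᵐ γ ∂μ, CurveClass.range γ ⊆ K) :
    (μ.map (CurveClass.map Φ)).real (CurveClass.hitsBefore (Φ '' A) (Φ '' B)) =
      μ.real (CurveClass.hitsBefore A B) := by
  have hA' : IsClosed (Φ '' A) := (hA.image Φ.continuous).isClosed
  have hB' : IsClosed (Φ '' B) := (hB.image Φ.continuous).isClosed
  rw [map_measureReal_apply (CurveClass.measurable_map Φ)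
    (CurveClass.measurableSet_hitsBefore_holds hA' hB')]
  refine measureReal_congr ?_
  have hΦ : InjOn Φ K := fun x hx y hy hxy => by rw [← hΨΦ x hx, ← hΨΦ y hy, hxy]
  have hΨ : InjOn Ψ (Φ '' K) := by
    rintro _ ⟨x, hx, rfl⟩ _ ⟨y, hy, rfl⟩ hxy
    rw [hΨΦ x hx, hΨΦ y hy] at hxy
    rw [hxy]
  have hid : ∀ C ⊆ K, Ψ '' (Φ '' C) = C := fun C hC => by
    rw [image_image]
    have : (fun x => Ψ (Φ x)) '' C = id '' C := image_congr fun x hx => hΨΦ x (hC hx)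
    rw [this, image_id]
  filter_upwards [hμ] with γ hγ
  change (γ ∈ CurveClass.map Φ ⁻¹' CurveClass.hitsBefore (Φ '' A) (Φ '' B)) =
    (γ ∈ CurveClass.hitsBefore A B)
  refine propext ⟨fun h => ?_, fun h => map_mem_hitsBefore_of_injOn hΦ hBK hγ h⟩
  have hγ' : (CurveClass.map Φ γ).range ⊆ Φ '' K := by
    rw [CurveClass.range_map]
    exact image_mono hγ
  have h2 := map_mem_hitsBefore_of_injOn hΨ (image_mono hBK) hγ' h
  have hmap : CurveClass.map Ψ (CurveClass.map Φ γ) = γ := by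
    obtain ⟨g, rfl⟩ := CurveClass.surjective_mk γ
    rw [CurveClass.map_mk, CurveClass.map_mk]
    congr 1
    refine Curve.ext (ContinuousMap.ext fun t => ?_)
    change Ψ (Φ (g t)) = g t
    exact hΨΦ _ (hγ (by rw [CurveClass.range_mk]; exact ⟨t, rfl⟩))
  rwa [hmap, hid A hAK, hid B hBK] at h2

/-- **A continuous left inverse, on the whole plane, of a map injective on a compact set**
(inverse of a continuous bijection of a compact set, then Tietze's extension theorem for the
Tietze space `ℂ`). -/
theorem exists_leftInverse_of_injOn_isCompact {K : Set ℂ} (hK : IsCompact K) (Φ : C(ℂ, ℂ))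
    (hΦ : InjOn Φ K) : ∃ Ψ : C(ℂ, ℂ), ∀ x ∈ K, Ψ (Φ x) = x := by
  have hc : ContinuousOn (Function.invFunOn Φ K) (Φ '' K) :=
    continuousOn_invFunOn_of_isCompact hK Φ.continuous.continuousOn hΦ.bijOn_image
  have hcl : IsClosed (Φ '' K) := (hK.image Φ.continuous).isClosed
  obtain ⟨Ψ, hΨ⟩ := ContinuousMap.exists_restrict_eq (Y := ℂ) hcl
    ⟨(Φ '' K).restrict (Function.invFunOn Φ K), hc.restrict⟩
  refine ⟨Ψ, fun x hx => ?_⟩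
  have h1 : Ψ (Φ x) = Function.invFunOn Φ K (Φ x) := by
    have := congrArg (fun f => f ⟨Φ x, mem_image_of_mem Φ hx⟩) hΨ
    simpa using this
  rw [h1]
  exact hΦ.leftInvOn_invFunOn hx

/-- **Transport of crossing probabilities along a map injective on a compact set carrying the
traces**: `(Φ_* μ) (hitsBefore (Φ '' A) (Φ '' B)) = μ (hitsBefore A B)` for compact
`A, B ⊆ K`, `K` compact, `Φ` continuous on `ℂ` and injective on `K`, and `μ`-a.e. trace in `K`. -/
theorem measureReal_hitsBefore_map_eq_of_injOn {μ : Measure (CurveClass ℂ)} {K A B : Set ℂ}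
    {Φ : C(ℂ, ℂ)} (hK : IsCompact K) (hA : IsCompact A) (hB : IsCompact B) (hAK : A ⊆ K)
    (hBK : B ⊆ K) (hΦ : InjOn Φ K) (hμ : ∀ᵐ γ ∂μ, CurveClass.range γ ⊆ K) :
    (μ.map (CurveClass.map Φ)).real (CurveClass.hitsBefore (Φ '' A) (Φ '' B)) =
      μ.real (CurveClass.hitsBefore A B) := by
  obtain ⟨Ψ, hΨ⟩ := exists_leftInverse_of_injOn_isCompact hK Φ hΦ
  exact measureReal_hitsBefore_map_eq hA hB hAK hBK hΨ hμ

/-! ### The exit probability is a conformal invariant of the marked rectangle -/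

/-- Registered helper `exitRigidity_exitFunction` (for stub `stub_exitRigidity`, line
`SketchIdeatorTwo` of crux stmt-CriticalPhenomena-17239). **The exit probability
`h_P(R) = P_{(Ω;a,c)}(γ hits (cd) before (bc))` of a conformally covariant chordal family is
invariant under univalent maps of the closed rectangle**: if `Φ : ℂ → ℂ` is continuous,
holomorphic on `Ω = R.carrier` and injective on `closure Ω`, and `S` is any conformal rectangle
with carrier `Φ '' Ω`, first and third marks `Φ a`, `Φ c`, and second and third arcs
`Φ '' R.arc 1`, `Φ '' R.arc 2`, then `h_P(R) = h_P(S)`. Proof: `P (S; Φa, Φc) = Φ_* P (Ω; a, c)`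
by conformal covariance (`IsConformallyCovariant.eq_map_of_image`: `Φ|Ω` is a conformal
equivalence with boundary values `Φ a`, `Φ c`), `P (Ω; a, c)` is carried by curves in
`closure Ω` (`IsChordal`), and the crossing event transports along `Φ`
(`measureReal_hitsBefore_map_eq_of_injOn`). This is the "exit function exists" half of FL4:
with Pommerenke's rectangle uniformization (§2.3 Ex. 2, Thm. 2.6) `h_P` factors through the
conformal modulus on each boundary-orientation class. -/
theorem exitRigidity_exitFunction : ∀ P : ChordalFamily, P.IsChordal → P.IsConformallyCovariant → ∀ (R S : ConformalRectangle) (Φ : C(ℂ, ℂ)), DifferentiableOn ℂ Φ R.carrier → Set.InjOn Φ (closure R.carrier) → S.carrier = Φ '' R.carrier → S.pt 0 = Φ (R.pt 0) → S.pt 2 = Φ (R.pt 2) → S.arc 1 = Φ '' R.arc 1 → S.arc 2 = Φ '' R.arc 2 → (P (R.chord 0 2 (by decide))).real (CurveClass.hitsBefore (R.arc 2) (R.arc 1)) = (P (S.chord 0 2 (by decide))).real (CurveClass.hitsBefore (S.arc 2) (S.arc 1)) := by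
  intro P hP hcov R S Φ hd hi hS h0 h2 ha1 ha2
  have heq : P (S.chord 0 2 (by decide)) = (P (R.chord 0 2 (by decide))).map (CurveClass.map Φ) :=
    hcov.eq_map_of_image (D := R.chord 0 2 (by decide)) (D' := S.chord 0 2 (by decide)) hd
      (hi.mono subset_closure) hS h0 h2
  have hcar : ∀ᵐ γ ∂(P (R.chord 0 2 (by decide))), CurveClass.range γ ⊆ closure R.carrier :=
    (hP (R.chord 0 2 (by decide))).2.mono fun γ h => h.2.2
  rw [heq, ha1, ha2]
  exact (measureReal_hitsBefore_map_eq_of_injOn R.isBounded.isCompact_closure (R.isCompact_arc 2)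
    (R.isCompact_arc 1) ((R.arc_subset_frontier 2).trans frontier_subset_closure)
    ((R.arc_subset_frontier 1).trans frontier_subset_closure) hi hcar).symm

/-- **Reflection / isometry form.** For an isometry covariant family (`IsIsometryCovariant`:
`P (φ D) = φ_* (P D)` for every isometry `φ` of the plane, in particular the reflections
`z ↦ c z̄ + w`) the exit probability of the reflected rectangle `φ R` equals that of `R`; no
chordality is needed since `φ` is injective on the whole plane with continuous inverse. This
closes the orientation gap of `exitRigidity_exitFunction`: a reflection reverses the boundary
orientation, which no conformal map does. -/
theorem exitRigidity_exitFunction_isometry : ∀ P : ChordalFamily, P.IsIsometryCovariant →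
    ∀ (R : ConformalRectangle) (φ : ℂ ≃ₜ ℂ), Isometry φ →
      (P ((R.map φ).chord 0 2 (by decide))).real
          (CurveClass.hitsBefore ((R.map φ).arc 2) ((R.map φ).arc 1)) =
        (P (R.chord 0 2 (by decide))).real (CurveClass.hitsBefore (R.arc 2) (R.arc 1)) := by
  intro P hiso R φ hφ
  have hchord : (R.map φ).chord 0 2 (by decide) = (R.chord 0 2 (by decide)).map φ := rfl
  rw [hchord, hiso _ φ hφ, MarkedDomain.arc_map, MarkedDomain.arc_map]
  exact measureReal_hitsBefore_map_eq (K := univ) (Ψ := (φ.symm : C(ℂ, ℂ))) (R.isCompact_arc 2)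
    (R.isCompact_arc 1) (subset_univ _) (subset_univ _) (fun x _ => φ.symm_apply_apply x)
    (Eventually.of_forall fun γ => subset_univ _)

end Summit.CriticalPhenomena.CardyFormulaZ2.Theorems.SymmetryUpgradeR.SwallowingSkeleton
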